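import Summits.BirchSwinnertonDyer.BirchSwinnertonDyer.Theorems.PrintCf2SplitBadTwistCurrency
import Summits.BirchSwinnertonDyer.BirchSwinnertonDyer.Theorems.PrintCf2MaximalOrderReduction
import Summits.BirchSwinnertonDyer.Rank1Residual.P2.SplitBadTwistTypes
import Literature.NumberTheory.EllipticCurves.NonvanishingTwistsAdmissibleFieldOfFriedbergHoffsteinProofs
import Literature.NumberTheory.EllipticCurves.BSDRootNumberModularityOnlyProofs
import Literature.NumberTheory.EllipticCurves.BSDRootNumberSmallConductorAssemblyProofs
import Literature.NumberTheory.EllipticCurves.AnalyticRankModularityProofs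
import Literature.NumberTheory.EllipticCurves.AnalyticRankOrderProofs
import Literature.NumberTheory.EllipticCurves.LFunctionSmulProofs
import HarnessLib

set_option linter.dupNamespace false -- `…BirchSwinnertonDyer.BirchSwinnertonDyer…` is the cell's namespace (D-0017)
set_option autoImplicit false

/-!
# Crux `PrintCf2.SplitBadTwoRankOneOfFacts` (item stmt-BirchSwinnertonDyer-20368), line `parity_crossing_two`
# (skeleton c595eca72cac, bsd-idea-7 g2): the RANK-ZERO PARTNER EXISTS FROM PRINT (Friedberg–Hoffstein currency),
# and the registered transfer stub is the crux itself in the kernel (critic-10 VERDICT #12, BC2)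

Cell `bsd-print-cf2`, lead `bsd-line-cf2-p1` g2. Helper for item 20368 (no `def`, no named fact introduced, no `sorry`).
HONEST FRAMING: nothing is proved about BSD. The class: globally minimal `W′/ℚ` with `C • W′ = 49a1^{(d)}`
(`cm7 = [1,−1,0,−2,−1]`), `d` squarefree, `d ≢ 1 (mod 4)` (CM by `ℚ(√−7)`, `2` split in `K`, additive at `2`),
`r_an(W′) = 1`; bundle `𝔅_split = GZK ∧ MOD ∧ CAS ∧ BF24 ∧ KL112` (antecedent of the crux).

§1 MEMBER FACTS (fact-free): `j(W′) = −3375`, `W′` has CM with `2` split, `W′` is bad at `2`.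
§2 PARITY FROM MODULARITY (used inline): `r_an(W′) = 1 ⟹ w(W′) = −1`, from the named print
`ModularForms.exists_isNewformOf` (BCDT 2001) and Hecke's functional equation PROVED in the tree, through
`even_analyticRank_iff_rootNumber_eq_one_of_exists_isNewformOf` (cf. `Rank1Residual.O5.HeegnerLogTransport`).
§3 THE PARTNER (re-cut of registered stub `stub_rankZeroPrimeTwistPartner` per critic-10 VERDICT #12 (P3): fundamental
discriminants with prescribed splitting instead of «prime ℓ ≡ 7 (mod 8) in Ono's Frobenian set», which is not print
uniformly in `d`): granted `exists_isNewformOf` and Friedberg–Hoffstein 1995 Thm. B in the tree's finite-set form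
`friedbergHoffstein_exists_heegnerField_splitDivisors_twist_ne_zero` (as used by Jetchev–Skinner–Wan 2017 §7.4.1 and
Burungale–Skinner–Tian–Wan 2024), EVERY member `W′` has an imaginary quadratic `K″` with `d_{K″} ≡ 1 (mod 8)` in which every
prime of `N(W′)`, `2` and `7` split, `L(W′^{(d_{K″})}, 1) ≠ 0`, and a globally minimal model `W₁` of `W′^{(d_{K″})}` which is
CM (`j = −3375`), of analytic rank ZERO, and again a twist `49a1^{(d·d_{K″})}` — `exists_rankZero_heegnerPartner_of_print`.
Under `𝔅_split` (`MOD ∧ BF24`) that partner satisfies `BSD(W₁, 2)` (`bsdp_two_of_hasCM_of_analyticRank_eq_zero_of_bundle`).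
§4 THE KERNEL CUT OF THE REGISTERED SKELETON IS EMPTY (critic-10 BC2, now a theorem): the crux implies the registered
transfer stub `stub_parityCrossingTransferTwo` outright (`parityCrossingTransferTwo_of_splitBadTwoRankOneOfFacts`), and
granted the registered partner stub the two are EQUIVALENT (`parityCrossingTransferTwo_iff_splitBadTwoRankOneOfFacts`).
§5 THE SAME FOR THE RE-CUT (Heegner-field currency): crux ⟹ transfer′; and `exists_isNewformOf ∧ FH ⟹ (transfer′ ⟺ crux)`
— the one-line closer of an `…OfFactsPlus` twin «`𝔅_split ∧ exists_isNewformOf ∧ FH ∧ transfer′ ⟹` class» (K7t doctrine)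
is `splitBadTwoRankOneOfFacts_of_heegnerTransfer_of_print`.

References: [FriedbergHoffstein1995] Thm. B; [JetchevSkinnerWan2017] §7.4.1–7.4.2; [BCDTJAMS2001] Thm. A;
[DiamondShurman2005] Thm. 5.10.2; [SilvermanAEC2009] C.16 Thm. 16.3, X.5 Cor. 5.4.1, VIII.8 Cor. 8.3; [Miller2011LMS] Def. 1.1;
[BurungaleFlach2024] Cor. 2; the line card `Cruxes/SplitBadTwoRankOneOfFacts/Lines/parity-crossing-two.md`; critic-10
VERDICT #12 (HOME/INBOX 2026-08-28T06:04:36Z). BSD is not proved by any of this.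
-/

noncomputable section

open scoped Classical

open WeierstrassCurve Literature.NumberTheory Literature.NumberTheory.EllipticCurves
  Literature.NumberTheory.EllipticCurves.Rank1Residual Literature.NumberTheory.EllipticCurves.ModularForms
  Summit.BirchSwinnertonDyer.BirchSwinnertonDyer.Theses.PrintCf2
  Summit.BirchSwinnertonDyer.Rank1Residual.P2.SplitBadTwistTypes

namespace Summit.BirchSwinnertonDyer.BirchSwinnertonDyer.Theorems.PrintCf2

/-! ## §1 Member facts (fact-free) -/

/-- A `ℚ`-model `W′` of `49a1^{(d)}` (`d ≠ 0`) has `j(W′) = −3375`, hence CM by `ℚ(√−7)` with `2` split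
(`CMSplit W′ 2`). [cite: SilvermanAEC2009, X.5 Cor. 5.4] -/
theorem hasCM_and_cmSplit_two_of_smul_eq_cm7_quadraticTwist {d : ℤ} (hd : d ≠ 0) (W' : WeierstrassCurve ℚ)
    [W'.IsElliptic] {C : VariableChange ℚ} (hC : C • W' = cm7.quadraticTwist (d : ℚ)) :
    W'.HasCM ∧ CMSplit W' 2 :=
  hasCM_and_cmSplit_two_of_j_eq_neg3375
    (j_eq_neg3375_of_smul_eq_cm7_quadraticTwist W' (by exact_mod_cast hd) hC)

/-- A globally minimal `ℚ`-model `W′` of `49a1^{(d)}`, `d` squarefree with `d ≢ 1 (mod 4)`, is BAD at `2`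
(ty2 g12's `hasGoodReductionAtPrime_two_iff_emod_four_of_smul_eq_cm7_quadraticTwist`).
[cite: SilvermanAEC2009, VII.1 Prop. 1.3(b), VIII.8 Cor. 8.3] -/
theorem not_good_two_of_smul_eq_cm7_quadraticTwist {d : ℤ} (hsq : Squarefree d) (h4 : d % 4 ≠ 1)
    (W' : WeierstrassCurve ℚ) [W'.IsGloballyMinimal] {C : VariableChange ℚ}
    (hC : C • W' = cm7.quadraticTwist (d : ℚ)) : ¬ Good W' 2 :=
  fun hg ↦ h4 ((hasGoodReductionAtPrime_two_iff_emod_four_of_smul_eq_cm7_quadraticTwist W' hsq hC).mp hg)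

/-! ## §3 The rank-zero partner through a Heegner field with `2` split, from print -/

/-- **THE RANK-ZERO HEEGNER PARTNER EXISTS, FROM PRINT** (re-cut of the registered stub `stub_rankZeroPrimeTwistPartner`
of line `parity_crossing_two` into Friedberg–Hoffstein currency). Granted Modularity (`exists_isNewformOf`) and
Friedberg–Hoffstein 1995 Thm. B in the tree's finite-set form: for every `ℚ`-model `W′` of `49a1^{(d)}` (`d ≠ 0`) of
analytic rank one there are an imaginary quadratic field `K″` with `d_{K″} ≡ 1 (mod 8)` in which every prime dividing
`N(W′)` splits (Heegner hypothesis) and `2`, `7` split, and a globally minimal model `W₁` of the twist `W′^{(d_{K″})}`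
(`C₁ • W₁ = W′^{(d_{K″})}`) which has CM (`j = −3375`), analytic rank ZERO (`L(W′^{(d_{K″})}, 1) ≠ 0`), and is a `ℚ`-model
of `49a1^{(d·d_{K″})}`. Proof: `w(W′) = −1` (parity from modularity); Friedberg–Hoffstein with the primes of `N(W′)`, `2`, `7` prescribed split
(`Rank1Residual.exists_admissibleField_discr_emod_eight_of_friedbergHoffstein`); Néron's global minimal model; `j` and
`L` are isomorphism/twist invariants (`variableChange_j`, `j_quadraticTwist`, `analyticRank_smul`); `r_an = 0 ⟺ L(1) ≠ 0`
(`analyticRank_eq_zero_iff_holds`, continuation from modularity).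
[cite: FriedbergHoffstein1995, Thm. B (as applied in JetchevSkinnerWan2017 §7.4.1)] [cite: BCDTJAMS2001, Thm. A]
[cite: SilvermanAEC2009, X.5 Cor. 5.4.1 and VIII.8 Cor. 8.3] -/
theorem exists_rankZero_heegnerPartner_of_print (hmod : exists_isNewformOf)
    (hFH : friedbergHoffstein_exists_heegnerField_splitDivisors_twist_ne_zero)
    {d : ℤ} (hd : d ≠ 0) (W' : WeierstrassCurve ℚ) [W'.IsElliptic] {C : VariableChange ℚ}
    (hC : C • W' = cm7.quadraticTwist (d : ℚ)) (hr : W'.analyticRank = 1) :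
    ∃ (K : Type) (_ : Field K) (_ : NumberField K) (W₁ : WeierstrassCurve ℚ) (_ : W₁.IsElliptic)
      (_ : W₁.IsGloballyMinimal) (C₁ : VariableChange ℚ),
      IsImaginaryQuadratic K ∧ NumberField.discr K % 8 = 1 ∧
        SatisfiesHeegnerHypothesis (W'.conductorNorm ℤ) K ∧ SatisfiesHeegnerHypothesis 2 K ∧
        SatisfiesHeegnerHypothesis 7 K ∧
        (W'.quadraticTwist (NumberField.discr K : ℚ)).entireLFunction 1 ≠ 0 ∧
        C₁ • W₁ = W'.quadraticTwist (NumberField.discr K : ℚ) ∧ W₁.HasCM ∧ W₁.analyticRank = 0 ∧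
        ∃ C' : VariableChange ℚ, C' • W₁ = cm7.quadraticTwist ((d * NumberField.discr K : ℤ) : ℚ) := by
  -- parity from modularity (bsd.S36 from `exists_isNewformOf` + Hecke, tree): `r_an = 1 ⟹ w = −1`
  have hw : W'.rootNumber = -1 := by
    rw [even_analyticRank_iff_rootNumber_eq_one.rootNumber_eq_neg_one_pow
      (even_analyticRank_iff_rootNumber_eq_one_of_exists_isNewformOf W' hmod), hr, pow_one]
  haveI : Fact (Nat.Prime 7) := ⟨by norm_num⟩
  obtain ⟨K, _, _, hK, h8, -, -, hHN, hH2, hH7, hL⟩ :=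
    Rank1Residual.exists_admissibleField_discr_emod_eight_of_friedbergHoffstein hFH W' hw 7 0
  have hD0 : ((NumberField.discr K : ℤ) : ℚ) ≠ 0 := by
    exact_mod_cast (IsImaginaryQuadratic.discr_neg hK).ne
  haveI hE : (W'.quadraticTwist (NumberField.discr K : ℚ)).IsElliptic := W'.isElliptic_quadraticTwist hD0
  obtain ⟨C₃, hmin⟩ := hasGlobalMinimalModel_rat_holds (W'.quadraticTwist (NumberField.discr K : ℚ))
  have hd' : (d : ℚ) ≠ 0 := by exact_mod_cast hd
  have hj : (C₃ • W'.quadraticTwist (NumberField.discr K : ℚ)).j = -3375 := by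
    rw [variableChange_j, j_quadraticTwist W' hD0, j_eq_neg3375_of_smul_eq_cm7_quadraticTwist W' hd' hC]
  have hr0 : (C₃ • W'.quadraticTwist (NumberField.discr K : ℚ)).analyticRank = 0 := by
    rw [analyticRank_smul]
    exact ((W'.quadraticTwist (NumberField.discr K : ℚ)).analyticRank_eq_zero_iff_holds
      (hasEntireLFunction_rat_of_exists_isNewformOf hmod _)).mpr hL
  obtain ⟨C', hC'⟩ := exists_smul_quadraticTwist_eq_of_smul_eq_quadraticTwist hC (NumberField.discr K : ℚ)
  refine ⟨K, inferInstance, inferInstance, C₃ • W'.quadraticTwist (NumberField.discr K : ℚ), inferInstance,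
    hmin, C₃⁻¹, hK, h8, hHN, hH2, hH7, hL, inv_smul_smul C₃ _, (hasCM_and_cmSplit_two_of_j_eq_neg3375 hj).1,
    hr0, C' * C₃⁻¹, ?_⟩
  rw [mul_smul, inv_smul_smul, hC']
  push_cast
  rfl

/-- **The bundle pays for the partner** (the skeleton's `rankZeroTwistBSDpTwo_of_bundle`, restated for import): under
`𝔅_split` — its conjuncts `MOD` (`hasEntireLFunction_rat`) and `BF24` (`bsdTriple_of_hasCM_of_L_one_ne_zero`,
Burungale–Flach 2024 Cor. 2, every prime) — every globally minimal CM curve `W₁/ℚ` of analytic rank zero satisfies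
`BSD(W₁, 2)`. [cite: BurungaleFlach2024, Cor. 2] [cite: Miller2011LMS, Def. 1.1] -/
theorem bsdp_two_of_hasCM_of_analyticRank_eq_zero_of_bundle
    (hB : rank_eq_analyticRank_of_analyticRank_le_one ∧ hasEntireLFunction_rat ∧ bsdRHS_eq_of_isIsogenous ∧
      bsdTriple_of_hasCM_of_L_one_ne_zero ∧ KrizLi2019.thm112_bsdTwo_twist)
    (W₁ : WeierstrassCurve ℚ) [W₁.IsElliptic] [W₁.IsGloballyMinimal] (hCM : W₁.HasCM)
    (hr0 : W₁.analyticRank = 0) : BSDp W₁ 2 :=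
  have hL : W₁.entireLFunction 1 ≠ 0 := (W₁.analyticRank_eq_zero_iff_holds (hB.2.1 W₁)).mp hr0
  forall_bsdp_of_bsdTriple' W₁ (hB.2.2.2.1 W₁ hCM hL) 2 Nat.prime_two

/-- **The re-cut partner stub, CLOSED modulo the two named prints**: granted `exists_isNewformOf` and Friedberg–Hoffstein,
the Heegner-field form of stub 1 of line `parity_crossing_two` holds for every member of the class (the statement below is
VERBATIM the lead's re-cut `stub_rankZeroHeegnerPartner` of the reshaped skeleton, with the two prints as hypotheses).
[cite: FriedbergHoffstein1995, Thm. B] [cite: BCDTJAMS2001, Thm. A] -/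
theorem rankZeroHeegnerPartner_of_print (hmod : exists_isNewformOf)
    (hFH : friedbergHoffstein_exists_heegnerField_splitDivisors_twist_ne_zero) :
    ∀ (d : ℤ), d ≠ 0 → Squarefree d → d % 4 ≠ 1 →
      ∀ (W' : WeierstrassCurve ℚ) [W'.IsElliptic] [W'.IsGloballyMinimal] (C : VariableChange ℚ),
        C • W' = cm7.quadraticTwist (d : ℚ) → W'.analyticRank = 1 →
        ∃ (K : Type) (_ : Field K) (_ : NumberField K) (W₁ : WeierstrassCurve ℚ) (_ : W₁.IsElliptic)
          (_ : W₁.IsGloballyMinimal) (C₁ : VariableChange ℚ),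
          IsImaginaryQuadratic K ∧ SatisfiesHeegnerHypothesis (W'.conductorNorm ℤ) K ∧
            SatisfiesHeegnerHypothesis 2 K ∧
            (W'.quadraticTwist (NumberField.discr K : ℚ)).entireLFunction 1 ≠ 0 ∧
            C₁ • W₁ = W'.quadraticTwist (NumberField.discr K : ℚ) ∧ W₁.HasCM ∧ W₁.analyticRank = 0 := by
  intro d hd _ _ W' _ _ C hC hr
  obtain ⟨K, _, _, W₁, _, _, C₁, hK, -, hHN, hH2, -, hL, hC₁, hCM, hr0, -⟩ :=
    exists_rankZero_heegnerPartner_of_print hmod hFH hd W' hC hr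
  exact ⟨K, inferInstance, inferInstance, W₁, inferInstance, inferInstance, C₁, hK, hHN, hH2, hL, hC₁, hCM, hr0⟩

/-! ## §4 The registered kernel cut is empty: `stub_parityCrossingTransferTwo` ⟺ crux, granted the partner stub -/

/-- **Crux ⟹ registered transfer stub** (`stub_parityCrossingTransferTwo` of skeleton c595eca72cac, signature VERBATIM as the
conclusion): the partner data (`ℓ`, `W₁`, `C₁`, `BSDp W₁ 2`) are idle — a member `W′` is CM with `2` split, bad at `2`, of
analytic rank one, so the crux gives `BSD(W′, 2)` directly (`bsdp_two_twist_cm7_of_splitBadTwoRankOneOfFacts`).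
[cite: Miller2011LMS, Def. 1.1] [cite: SilvermanAEC2009, X.5 Cor. 5.4.1] -/
theorem parityCrossingTransferTwo_of_splitBadTwoRankOneOfFacts (h : SplitBadTwoRankOneOfFacts)
    (hB : rank_eq_analyticRank_of_analyticRank_le_one ∧ hasEntireLFunction_rat ∧ bsdRHS_eq_of_isIsogenous ∧
      bsdTriple_of_hasCM_of_L_one_ne_zero ∧ KrizLi2019.thm112_bsdTwo_twist) :
    ∀ (d : ℤ), d ≠ 0 → Squarefree d → d % 4 ≠ 1 →
      ∀ (W' : WeierstrassCurve ℚ) [W'.IsElliptic] [W'.IsGloballyMinimal] (C : VariableChange ℚ),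
        C • W' = cm7.quadraticTwist (d : ℚ) → W'.analyticRank = 1 →
        ∀ (ℓ : ℕ) (W₁ : WeierstrassCurve ℚ) [W₁.IsElliptic] [W₁.IsGloballyMinimal] (C₁ : VariableChange ℚ),
          ℓ.Prime → ℓ % 8 = 7 → ¬ ((ℓ : ℤ) ∣ 7 * d) →
          C₁ • W₁ = W'.quadraticTwist (-(ℓ : ℚ)) → W₁.analyticRank = 0 → BSDp W₁ 2 → BSDp W' 2 :=
  fun _ hd hsq h4 W' _ _ C hC hr _ _ _ _ _ _ _ _ _ _ _ ↦
    bsdp_two_twist_cm7_of_splitBadTwoRankOneOfFacts h hB hd W' C hC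
      (not_good_two_of_smul_eq_cm7_quadraticTwist hsq h4 W' hC) hr

/-- **BC2 of critic-10 VERDICT #12 as a theorem: granted the registered partner stub (`stub_rankZeroPrimeTwistPartner`,
hypothesis `h1`, VERBATIM), the registered transfer stub (`stub_parityCrossingTransferTwo`, left side VERBATIM with its
bundle binder explicit) is EQUIVALENT to the crux** — (⟸) by the previous theorem; (⟹) is the skeleton's own composition
(`SplitBadTwoRankOneOfFacts_of`: twist currency `splitBadTwoRankOneOfFacts_of_twists`, partner from `h1`, `BSD(W₁,2)` from
the bundle). So the registered cut S1 | S2 carries no reduction of the crux. [cite: Miller2011LMS, Def. 1.1] -/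
theorem parityCrossingTransferTwo_iff_splitBadTwoRankOneOfFacts
    (h1 : ∀ (d : ℤ), d ≠ 0 → Squarefree d → d % 4 ≠ 1 →
      ∀ (W' : WeierstrassCurve ℚ) [W'.IsElliptic] [W'.IsGloballyMinimal] (C : VariableChange ℚ),
        C • W' = cm7.quadraticTwist (d : ℚ) → W'.analyticRank = 1 →
        ∃ (ℓ : ℕ) (W₁ : WeierstrassCurve ℚ) (_ : W₁.IsElliptic) (_ : W₁.IsGloballyMinimal) (C₁ : VariableChange ℚ),
          ℓ.Prime ∧ ℓ % 8 = 7 ∧ ¬ ((ℓ : ℤ) ∣ 7 * d) ∧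
          C₁ • W₁ = W'.quadraticTwist (-(ℓ : ℚ)) ∧ W₁.HasCM ∧ W₁.analyticRank = 0) :
    (∀ (_ : rank_eq_analyticRank_of_analyticRank_le_one ∧ hasEntireLFunction_rat ∧
        bsdRHS_eq_of_isIsogenous ∧ bsdTriple_of_hasCM_of_L_one_ne_zero ∧ KrizLi2019.thm112_bsdTwo_twist),
      ∀ (d : ℤ), d ≠ 0 → Squarefree d → d % 4 ≠ 1 →
        ∀ (W' : WeierstrassCurve ℚ) [W'.IsElliptic] [W'.IsGloballyMinimal] (C : VariableChange ℚ),
          C • W' = cm7.quadraticTwist (d : ℚ) → W'.analyticRank = 1 →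
          ∀ (ℓ : ℕ) (W₁ : WeierstrassCurve ℚ) [W₁.IsElliptic] [W₁.IsGloballyMinimal] (C₁ : VariableChange ℚ),
            ℓ.Prime → ℓ % 8 = 7 → ¬ ((ℓ : ℤ) ∣ 7 * d) →
            C₁ • W₁ = W'.quadraticTwist (-(ℓ : ℚ)) → W₁.analyticRank = 0 → BSDp W₁ 2 → BSDp W' 2) ↔
      SplitBadTwoRankOneOfFacts := by
  refine ⟨fun h2 hB ↦ splitBadTwoRankOneOfFacts_of_twists (fun d hd hsq h4 W' _ _ C hC hr ↦ ?_) hB,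
    fun h hB ↦ parityCrossingTransferTwo_of_splitBadTwoRankOneOfFacts h hB⟩
  obtain ⟨ℓ, W₁, _, _, C₁, hℓ, h8, hcop, htw, hCM₁, hr₁⟩ := h1 d hd hsq h4 W' C hC hr
  exact h2 hB d hd hsq h4 W' C hC hr ℓ W₁ C₁ hℓ h8 hcop htw hr₁
    (bsdp_two_of_hasCM_of_analyticRank_eq_zero_of_bundle hB W₁ hCM₁ hr₁)

/-! ## §5 The same for the re-cut (Heegner-field currency), and the `…OfFactsPlus` closer -/

/-- **Crux ⟹ re-cut transfer stub** (`stub_heegnerTransferTwo` of the lead's reshaped skeleton, signature VERBATIM as the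
conclusion; partner data idle as in §4). [cite: Miller2011LMS, Def. 1.1] -/
theorem heegnerTransferTwo_of_splitBadTwoRankOneOfFacts (h : SplitBadTwoRankOneOfFacts)
    (hB : rank_eq_analyticRank_of_analyticRank_le_one ∧ hasEntireLFunction_rat ∧ bsdRHS_eq_of_isIsogenous ∧
      bsdTriple_of_hasCM_of_L_one_ne_zero ∧ KrizLi2019.thm112_bsdTwo_twist) :
    ∀ (d : ℤ), d ≠ 0 → Squarefree d → d % 4 ≠ 1 →
      ∀ (W' : WeierstrassCurve ℚ) [W'.IsElliptic] [W'.IsGloballyMinimal] (C : VariableChange ℚ),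
        C • W' = cm7.quadraticTwist (d : ℚ) → W'.analyticRank = 1 →
        ∀ (K : Type) [Field K] [NumberField K] (W₁ : WeierstrassCurve ℚ) [W₁.IsElliptic] [W₁.IsGloballyMinimal]
          (C₁ : VariableChange ℚ),
          IsImaginaryQuadratic K → SatisfiesHeegnerHypothesis (W'.conductorNorm ℤ) K →
          SatisfiesHeegnerHypothesis 2 K →
          (W'.quadraticTwist (NumberField.discr K : ℚ)).entireLFunction 1 ≠ 0 →
          C₁ • W₁ = W'.quadraticTwist (NumberField.discr K : ℚ) → W₁.analyticRank = 0 → BSDp W₁ 2 →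
          BSDp W' 2 :=
  fun _ hd hsq h4 W' _ _ C hC hr _ _ _ _ _ _ _ _ _ _ _ _ _ _ ↦
    bsdp_two_twist_cm7_of_splitBadTwoRankOneOfFacts h hB hd W' C hC
      (not_good_two_of_smul_eq_cm7_quadraticTwist hsq h4 W' hC) hr

/-- **THE `…OfFactsPlus` CLOSER SHAPE (K7t doctrine): `exists_isNewformOf ∧ FH ∧` (re-cut transfer stub) `⟹` the crux** —
the reshaped skeleton's composition with its print stub discharged by hypothesis: twist currency, the partner of §3, the
bundle lemma, the transfer. A planner's aside «`𝔅_split ∧ exists_isNewformOf ∧ friedbergHoffstein_… ∧ transfer′ ⟹` class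
statement» closes by this term; equivalently the line closes the crux by name the moment the transfer stub is a theorem
AND the two prints are discharged. [cite: FriedbergHoffstein1995, Thm. B] [cite: BCDTJAMS2001, Thm. A] [cite: Miller2011LMS, Def. 1.1] -/
theorem splitBadTwoRankOneOfFacts_of_heegnerTransfer_of_print (hmod : exists_isNewformOf)
    (hFH : friedbergHoffstein_exists_heegnerField_splitDivisors_twist_ne_zero)
    (h2 : ∀ (_ : rank_eq_analyticRank_of_analyticRank_le_one ∧ hasEntireLFunction_rat ∧
        bsdRHS_eq_of_isIsogenous ∧ bsdTriple_of_hasCM_of_L_one_ne_zero ∧ KrizLi2019.thm112_bsdTwo_twist),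
      ∀ (d : ℤ), d ≠ 0 → Squarefree d → d % 4 ≠ 1 →
        ∀ (W' : WeierstrassCurve ℚ) [W'.IsElliptic] [W'.IsGloballyMinimal] (C : VariableChange ℚ),
          C • W' = cm7.quadraticTwist (d : ℚ) → W'.analyticRank = 1 →
          ∀ (K : Type) [Field K] [NumberField K] (W₁ : WeierstrassCurve ℚ) [W₁.IsElliptic] [W₁.IsGloballyMinimal]
            (C₁ : VariableChange ℚ),
            IsImaginaryQuadratic K → SatisfiesHeegnerHypothesis (W'.conductorNorm ℤ) K →
            SatisfiesHeegnerHypothesis 2 K →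
            (W'.quadraticTwist (NumberField.discr K : ℚ)).entireLFunction 1 ≠ 0 →
            C₁ • W₁ = W'.quadraticTwist (NumberField.discr K : ℚ) → W₁.analyticRank = 0 → BSDp W₁ 2 →
            BSDp W' 2) :
    SplitBadTwoRankOneOfFacts := fun hB ↦
  splitBadTwoRankOneOfFacts_of_twists (fun d hd hsq h4 W' _ _ C hC hr ↦ by
    obtain ⟨K, _, _, W₁, _, _, C₁, hK, hHN, hH2, hL, hC₁, hCM, hr0⟩ :=
      rankZeroHeegnerPartner_of_print hmod hFH d hd hsq h4 W' C hC hr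
    exact h2 hB d hd hsq h4 W' C hC hr K W₁ C₁ hK hHN hH2 hL hC₁ hr0
      (bsdp_two_of_hasCM_of_analyticRank_eq_zero_of_bundle hB W₁ hCM hr0)) hB

/-- **Granted the two prints, the re-cut transfer stub is EQUIVALENT to the crux** (so the re-cut does not change the
honest content either: the whole crux lives in the transfer; the parity crossing chooses the auxiliary field and makes the
CONSUMED `2`-part of BSD the rank-zero one, `BSD(W₁,2)`, a theorem of the bundle — a proof STRATEGY, not a reduction).
[cite: FriedbergHoffstein1995, Thm. B] [cite: BCDTJAMS2001, Thm. A] [cite: Miller2011LMS, Def. 1.1] -/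
theorem heegnerTransferTwo_iff_splitBadTwoRankOneOfFacts_of_print (hmod : exists_isNewformOf)
    (hFH : friedbergHoffstein_exists_heegnerField_splitDivisors_twist_ne_zero) :
    (∀ (_ : rank_eq_analyticRank_of_analyticRank_le_one ∧ hasEntireLFunction_rat ∧
        bsdRHS_eq_of_isIsogenous ∧ bsdTriple_of_hasCM_of_L_one_ne_zero ∧ KrizLi2019.thm112_bsdTwo_twist),
      ∀ (d : ℤ), d ≠ 0 → Squarefree d → d % 4 ≠ 1 →
        ∀ (W' : WeierstrassCurve ℚ) [W'.IsElliptic] [W'.IsGloballyMinimal] (C : VariableChange ℚ),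
          C • W' = cm7.quadraticTwist (d : ℚ) → W'.analyticRank = 1 →
          ∀ (K : Type) [Field K] [NumberField K] (W₁ : WeierstrassCurve ℚ) [W₁.IsElliptic] [W₁.IsGloballyMinimal]
            (C₁ : VariableChange ℚ),
            IsImaginaryQuadratic K → SatisfiesHeegnerHypothesis (W'.conductorNorm ℤ) K →
            SatisfiesHeegnerHypothesis 2 K →
            (W'.quadraticTwist (NumberField.discr K : ℚ)).entireLFunction 1 ≠ 0 →
            C₁ • W₁ = W'.quadraticTwist (NumberField.discr K : ℚ) → W₁.analyticRank = 0 → BSDp W₁ 2 →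
            BSDp W' 2) ↔
      SplitBadTwoRankOneOfFacts :=
  ⟨splitBadTwoRankOneOfFacts_of_heegnerTransfer_of_print hmod hFH,
    fun h hB ↦ heegnerTransferTwo_of_splitBadTwoRankOneOfFacts h hB⟩

end Summit.BirchSwinnertonDyer.BirchSwinnertonDyer.Theorems.PrintCf2

end
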